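import Mathlib
import HarnessLib
import Summits.HubbardSuperconductivity.HubbardSuperconductivity.Theorems.KLProgrammeKLRegimeEnginePairTransferOutClassForwardQuarterSplit3
import Summits.HubbardSuperconductivity.HubbardSuperconductivity.Theorems.KLProgrammeKLRegimeEnginePairTransferOutClassForwardCrossedQuarterSplit3
import Summits.HubbardSuperconductivity.HubbardSuperconductivity.Theorems.KLProgrammeKLRegimeEnginePairTransferMemberSplitCellsC

/-!
# Route `KLProgramme` — ENGINE stmt-HubbardSuperconductivity-20437 `KLRegimeEngineV17F2`, row (c) value lane «(c)-OUT»: the forward-window DIRECT member line, quarter thermal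
# share, UNDER THE CELL SPLIT `V_j⊗V_j = c₀ + F₁ + Σ_w F₂ʷ` with ANGULAR-CELL Lipschitz data (brick (L4)-2 of cure (A″) route 3′ of located «(c)-OUT-COOPER-ANTIPODE»;
# cell gate-hubbard-kl, seat hubbard-kl-k3c2-p2 g26, technique «thermal-bar induction n ≤ nScales β + 1 with EngineBoundsAtV4S sums»)

WHY.  `forward_member_direct_row_le_quarter_split3` books the forward-window direct member line through the SUP/GLOBAL-Lipschitz currency `hZS` of `F₁` — vacuous at the
Cooper antipode at deep scales (COOPER-ANTIPODE.md).  Here the member row is the angular-cell row `member_direct_signed_le_splitCellsC` (…MemberSplitCellsC): the zero-sound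
currency reads the ARC-WEIGHTED sum `I₁ = Σ_c Lc_c(β_c − α_c)` (`2L₁ ↦ I₁/(2π)`), the sharp constants of the TC family (`64/π·8`, transfer `(3·8·16^{j−(n+1)} + 512)` split
`64/π + 48/π·th`), the GLOBAL `K_g` only in the lattice entry, a new scale-free defect entry `(3/π)·DEF⋆` (`DEF⋆ = (128/π)·8·(π√2/d_A)·I_δ/(2π)`, `I_δ ∝ 1/L`), and the window entry
summed over the family `Σ_w A₂ʷ·4096·15381·(ρ_w/π + 1/L)` (cell flatness).  Same slots otherwise: `(Klam U)²·klEngGeo11.phGain (n+1) ρ + thermalBar/4 + 2·LAT/L + ε₁·2048·15367`.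
* `forward_row_arith_quarterC` (booking arithmetic in the TCC reading's shape);
* **`forward_member_direct_row_le_quarter_splitCells`**.
Composition/arithmetic over landed rows; the split and its data are binders; nothing asserts (E2″-F), (c), K3 or superconductivity.  0 kit · 0 lit.
-/

noncomputable section

namespace Summit.HubbardSuperconductivity.HubbardSuperconductivity.Theorems.KLRegimeSplit

set_option linter.dupNamespace false -- summit = problem name (single-conjunct summit), D-0017

open Real Set Finset Complex Literature.MathematicalPhysics.QuantumLattice
open Literature.Probability.LatticeModels hiding torusSupNorm
open Literature.MathematicalPhysics.QuantumLattice.BandSectorCounting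
open Summit.HubbardSuperconductivity.HubbardSuperconductivity.Theorems.KLProgrammeLegKernels
open Summit.HubbardSuperconductivity.HubbardSuperconductivity.Theorems.KLRegimeWick
open Summit.HubbardSuperconductivity.HubbardSuperconductivity.Theorems.TwoPointAssembly
open Summit.HubbardSuperconductivity.HubbardSuperconductivity.Theorems.EngineV8
open Summit.HubbardSuperconductivity.HubbardSuperconductivity.Theorems.DispersionFlow
open Summit.HubbardSuperconductivity.HubbardSuperconductivity.Theorems.PerturbedFermiCurve

/-! ## §0 Booking arithmetic in the angular-cell reading's shape -/

/-- **Booking arithmetic, quarter thermal share, angular-cell reading**: the zero-sound constant split as `Z_I + Z₀` (arc-weighted + `A₀` part), a scale-free defect `D ≥ 0`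
carried through as `(3/π)·D`, the transfer constant split `R_f + R_t·th` with `th ≤ 4q ≤ 4` (booked through `R_f + 4R_t`). -/
theorem forward_row_arith_quarterC {ZI Z0 D T Rf Rt Lt LL Λ₁ ρ th q G K CF : ℝ} {n : ℕ} (hΛ : Λ₁ = klE0 * ((4 : ℝ) ^ (n + 1))⁻¹) (hρ : 0 ≤ ρ) (hK : 0 ≤ K)
    (hZI0 : 0 ≤ ZI) (hZ00 : 0 ≤ Z0) (hZ : ZI + Z0 ≤ 2 ^ 52 * K) (hT0 : 0 ≤ T) (hT : T ≤ 2 ^ 76 * K) (hRf0 : 0 ≤ Rf) (hRt0 : 0 ≤ Rt) (hG : 0 ≤ G)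
    (hRG : (Rf + 4 * Rt) * G ≤ 2 ^ 52 * K) (hth0 : 0 ≤ th) (hq0 : 0 ≤ q) (hth : th ≤ 4 * q) (hq1 : q ≤ 1) (hCF : 2 ^ 80 ≤ CF) :
    2 * (3 / (2 * π) * (ZI * Λ₁ + D + Z0 * Λ₁ + T * th + (Rf + Rt * th) * ((|(0 : ℝ)| + G * ρ) / Λ₁)) + Lt / LL) ≤
      K * 2 ^ 28 * (2 ^ 24 * ((4 : ℝ) ^ (n + 1))⁻¹ + 2 ^ 24 * ρ / klE0 * (4 : ℝ) ^ (n + 1)) + CF * K * q / 4 + 2 * (Lt / LL) + 3 / π * D := by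
  have hπ := Real.pi_pos
  have hE0 : (0 : ℝ) < klE0 := by unfold klE0; norm_num
  have hΛpos : 0 < Λ₁ := by rw [hΛ]; positivity
  have hth4 : th ≤ 4 := hth.trans (by linarith)
  have hR : Rf + Rt * th ≤ Rf + 4 * Rt := by nlinarith
  have hm0 : 0 ≤ (|(0 : ℝ)| + G * ρ) / Λ₁ := by positivity
  have hold := forward_row_arith_quarter (Lt := Lt) (LL := LL) hΛ hρ hK (add_nonneg hZI0 hZ00) hZ hT0 hT (by positivity : 0 ≤ Rf + 4 * Rt) hG hRG hth0 hq0 hth hCF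
  have hmono : (Rf + Rt * th) * ((|(0 : ℝ)| + G * ρ) / Λ₁) ≤ (Rf + 4 * Rt) * ((|(0 : ℝ)| + G * ρ) / Λ₁) := mul_le_mul_of_nonneg_right hR hm0
  have e : 2 * (3 / (2 * π) * (ZI * Λ₁ + D + Z0 * Λ₁ + T * th + (Rf + Rt * th) * ((|(0 : ℝ)| + G * ρ) / Λ₁)) + Lt / LL) =
      2 * (3 / (2 * π) * ((ZI + Z0) * Λ₁ + T * th + (Rf + Rt * th) * ((|(0 : ℝ)| + G * ρ) / Λ₁)) + Lt / LL) + 3 / π * D := by ring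
  rw [e]
  have h3π0 : 0 ≤ 3 / (2 * π) := by positivity
  have : 2 * (3 / (2 * π) * ((ZI + Z0) * Λ₁ + T * th + (Rf + Rt * th) * ((|(0 : ℝ)| + G * ρ) / Λ₁)) + Lt / LL) ≤
      2 * (3 / (2 * π) * ((ZI + Z0) * Λ₁ + T * th + (Rf + 4 * Rt) * ((|(0 : ℝ)| + G * ρ) / Λ₁)) + Lt / LL) := by
    nlinarith [mul_le_mul_of_nonneg_left hmono h3π0]
  linarith

/-- **Booking arithmetic with a frequency shift, quarter thermal share, angular-cell reading** (`T + 2(R_f + 4R_t) ≤ 2⁷⁶K`). -/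
theorem forward_row_arith_shift_quarterC {ZI Z0 D T Rf Rt Lt LL Λ₁ ρ th q G K CF s : ℝ} {n : ℕ} (hΛ : Λ₁ = klE0 * ((4 : ℝ) ^ (n + 1))⁻¹) (hρ : 0 ≤ ρ) (hK : 0 ≤ K)
    (hZI0 : 0 ≤ ZI) (hZ00 : 0 ≤ Z0) (hZ : ZI + Z0 ≤ 2 ^ 52 * K) (hT0 : 0 ≤ T) (hRf0 : 0 ≤ Rf) (hRt0 : 0 ≤ Rt)
    (hTR : T + 2 * (Rf + 4 * Rt) ≤ 2 ^ 76 * K) (hG : 0 ≤ G) (hRG : (Rf + 4 * Rt) * G ≤ 2 ^ 52 * K)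
    (hth0 : 0 ≤ th) (hq0 : 0 ≤ q) (hth : th ≤ 4 * q) (hq1 : q ≤ 1) (hCF : 2 ^ 80 ≤ CF) (hs : s / Λ₁ = 2 * th) :
    2 * (3 / (2 * π) * (ZI * Λ₁ + D + Z0 * Λ₁ + T * th + (Rf + Rt * th) * ((|(0 : ℝ)| + (s + G * ρ)) / Λ₁)) + Lt / LL) ≤
      K * 2 ^ 28 * (2 ^ 24 * ((4 : ℝ) ^ (n + 1))⁻¹ + 2 ^ 24 * ρ / klE0 * (4 : ℝ) ^ (n + 1)) + CF * K * q / 4 + 2 * (Lt / LL) + 3 / π * D := by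
  have hπ := Real.pi_pos
  have hE0 : (0 : ℝ) < klE0 := by unfold klE0; norm_num
  have hΛpos : 0 < Λ₁ := by rw [hΛ]; positivity
  have hth4 : th ≤ 4 := hth.trans (by linarith)
  have hR : Rf + Rt * th ≤ Rf + 4 * Rt := by nlinarith
  have hs0 : 0 ≤ s := by
    have : 0 ≤ s / Λ₁ := by rw [hs]; positivity
    rcases lt_or_ge s 0 with h | h
    · exact absurd this (not_le.mpr (div_neg_of_neg_of_pos h hΛpos))
    · exact h
  have hm0 : 0 ≤ (|(0 : ℝ)| + (s + G * ρ)) / Λ₁ := by positivity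
  have hold := forward_row_arith_shift_quarter (Lt := Lt) (LL := LL) hΛ hρ hK (add_nonneg hZI0 hZ00) hZ hT0 (by positivity : 0 ≤ Rf + 4 * Rt) hTR hG hRG hth0 hq0
    hth hCF hs
  have hmono : (Rf + Rt * th) * ((|(0 : ℝ)| + (s + G * ρ)) / Λ₁) ≤ (Rf + 4 * Rt) * ((|(0 : ℝ)| + (s + G * ρ)) / Λ₁) := mul_le_mul_of_nonneg_right hR hm0
  have e : 2 * (3 / (2 * π) * (ZI * Λ₁ + D + Z0 * Λ₁ + T * th + (Rf + Rt * th) * ((|(0 : ℝ)| + (s + G * ρ)) / Λ₁)) + Lt / LL) =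
      2 * (3 / (2 * π) * ((ZI + Z0) * Λ₁ + T * th + (Rf + Rt * th) * ((|(0 : ℝ)| + (s + G * ρ)) / Λ₁)) + Lt / LL) + 3 / π * D := by ring
  rw [e]
  have h3π0 : 0 ≤ 3 / (2 * π) := by positivity
  have : 2 * (3 / (2 * π) * ((ZI + Z0) * Λ₁ + T * th + (Rf + Rt * th) * ((|(0 : ℝ)| + (s + G * ρ)) / Λ₁)) + Lt / LL) ≤
      2 * (3 / (2 * π) * ((ZI + Z0) * Λ₁ + T * th + (Rf + 4 * Rt) * ((|(0 : ℝ)| + (s + G * ρ)) / Λ₁)) + Lt / LL) := by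
    nlinarith [mul_le_mul_of_nonneg_left hmono h3π0]
  linarith

section Model

variable {L M : ℕ} [NeZero L] [NeZero M] {a' b' : ℝ} (B : BandBounds a' b') {R : RenConsts} {U μ : ℝ} {N : ℕ} {K : TrigPolyC4v} {A : ℝ}
set_option maxHeartbeats 400000 in
/-- **THE FORWARD-WINDOW DIRECT MEMBER LINE, QUARTER THERMAL SHARE, THREE-WAY KERNEL SPLIT** `V_j⊗V_j = c₀ + F₁ + F₂` (located-risk #9 «ZS-L1»): the
signed-row data are those of the CONSTANT `c₀` (proved zero Lipschitz/flatness) and of the O(1)-Lipschitz part `F₁` — `(A₀, L_A, ε) := (2‖c₀‖ + A₁, L₁, ε₁)` in the sizes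
`hZS hTH hTR` and in the lattice term — while the window-supported part `F₂` (sup `A₂`, support `|k − cen|_𝕋 ≤ ρw`) adds the DECAYING entry `A₂·4096·15381·(ρw/π + 1/L)`. -/
theorem forward_member_direct_row_le_quarter_splitCells (hR : ∀ j, 0 ≤ R.Gfr j) (hK : FrameOK R U N μ K)
    (hAb : ∀ p : Momentum, ∀ j ≤ 2, ‖iteratedFDeriv ℝ j (frameShift K) p‖ ≤ A) (hA : 4 * A < B.Dtmin) (hA20 : 4 * A ≤ 1 / 20) (hμ : μ ≤ -0.15)
    (n : ℕ) {t : ℝ} (ht : t ∈ Icc (0 : ℝ) 1) {β : ℝ} (hβ : klBetaMin ≤ β) (hn : n + 1 ≤ nScales β + 1)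
    (hM : β * (4 * klScale klE0 (n + 1)) / (2 * Real.pi) + 1 ≤ M)
    (Φ : ℕ → ℝ → FreqMomentum L M → ℝ) (hΦ : Φ = fun j t k => (softSymbolCompl L M β μ K (n + 1) j) k + (hubbardCutoffWeightCT L M β μ K (klScale klE0 (n + 1)) k -
            hubbardCutoffWeightCT L M β μ K (klScale klE0 n + t * (klScale klE0 (n + 1) - klScale klE0 n)) k))
    (Wd : ℝ → FreqMomentum L M → ℝ) (hWd : Wd = fun t k => deriv (fun Λ' : ℝ => hubbardCutoffWeightCT L M β μ K Λ' k) (klScale klE0 n + t * (klScale klE0 (n + 1) - klScale klE0 n)))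
    (V : ℕ → ℝ → (Fin 4 → HubbardFieldIdx L M) → ℂ) {j : ℕ} (hj : n + 1 ≤ j) (Qm x y : TorusSite 2 L)
    (hlo : a' < μ - 4 * klScale klE0 (n + 1) - 4 * A) (hhi : μ + 4 * klScale klE0 (n + 1) + 4 * A < b')
    (hq : (4 + 8 / 3 * R.Gfr 1 * U ^ 2) * klTorusNorm L (x - y) ≤ klScale klE0 (n + 1) / 8)
    (c₀ : ℂ) (F₁ : FreqMomentum L M → Fin 2 → FreqMomentum L M → ℂ) {ι' : Type*} [Fintype ι'] (F₂ : ι' → FreqMomentum L M → Fin 2 → FreqMomentum L M → ℂ)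
    (F₁₀ : TorusSite 2 L → Fin 2 → TorusSite 2 L → ℂ)
    (hsplit : ∀ (p : FreqMomentum L M) (σ : Fin 2) (p' : FreqMomentum L M),
      V j t ![((p, σ), 1), ((p', σ), 0), (((omega0 M, y), 0), 0), (((omega0 M, x), 0), 1)] *
          V j t ![((p, σ), 0), ((p', σ), 1), ((((omega0 M).rev, Qm - y), 1), 0), ((((omega0 M).rev, Qm - x), 1), 1)] = c₀ + F₁ p σ p' + ∑ w, F₂ w p σ p')
    {A₁ Kg ε₁ : ℝ} (hA1 : 0 ≤ A₁) (hKg : 0 ≤ Kg) (hε1 : 0 ≤ ε₁)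
    (hY0p₁ : ∀ k : TorusSite 2 L, ‖∑ σ : Fin 2, F₁₀ k σ (k + (x - y))‖ ≤ A₁)
    (hY1p₁ : ∀ k k' : TorusSite 2 L, ‖(∑ σ : Fin 2, F₁₀ k σ (k + (x - y))) - ∑ σ : Fin 2, F₁₀ k' σ (k' + (x - y))‖ ≤ Kg * klTorusNorm L (k - k'))
    (hY0m₁ : ∀ k : TorusSite 2 L, ‖∑ σ : Fin 2, F₁₀ (k + -(x - y)) σ k‖ ≤ A₁)
    (hY1m₁ : ∀ k k' : TorusSite 2 L, ‖(∑ σ : Fin 2, F₁₀ (k + -(x - y)) σ k) - ∑ σ : Fin 2, F₁₀ (k' + -(x - y)) σ k'‖ ≤ Kg * klTorusNorm L (k - k'))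
    {ι : Type*} [Fintype ι] {S : ι → Finset (TorusSite 2 L)} {αc βc Lc : ι → ℝ} (hαβ : ∀ c, αc c ≤ βc c) (hLc : ∀ c, 0 ≤ Lc c)
    {r : ℝ} (hr : 4 * klScale klE0 (n + 1) / (B.Dtmin - 4 * A) + Real.pi / L ≤ r)
    (hserve : ∀ c, ∀ θ ∈ Icc (αc c) (βc c), ∀ k : TorusSite 2 L,
      torusSupNorm (klpeP L k -
        (perturbedFermiRadius (fun k : Fin 2 → ℝ => frameShift K (WithLp.toLp 2 k)) μ θ * Real.cos θ,
          perturbedFermiRadius (fun k : Fin 2 → ℝ => frameShift K (WithLp.toLp 2 k)) μ θ * Real.sin θ)) ≤ r → k ∈ S c)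
    (hcover : ∀ θ ∈ Ioo (-π) π, ∃ c, θ ∈ Icc (αc c) (βc c))
    (hcellp : ∀ c, ∀ k ∈ S c, ∀ k' ∈ S c, ‖(∑ σ : Fin 2, F₁₀ k σ (k + (x - y))) - ∑ σ : Fin 2, F₁₀ k' σ (k' + (x - y))‖ ≤ Lc c * klTorusNorm L (k - k'))
    (hcellm : ∀ c, ∀ k ∈ S c, ∀ k' ∈ S c, ‖(∑ σ : Fin 2, F₁₀ (k + -(x - y)) σ k) - ∑ σ : Fin 2, F₁₀ (k' + -(x - y)) σ k'‖ ≤ Lc c * klTorusNorm L (k - k'))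
    (hflat₁ : ∀ (i : MatsubaraIdx M) (σ : Fin 2) (k k' : TorusSite 2 L), matsubaraFreq β M i ^ 2 ≤ (4 * klScale klE0 (n + 1)) ^ 2 →
      ‖F₁ (i, k) σ (i, k') - F₁₀ k σ k'‖ ≤ ε₁)
    (cen : ι' → TorusSite 2 L) {ρw A₂ : ι' → ℝ} (hρw : ∀ w, 0 ≤ ρw w) (hA2 : ∀ w, 0 ≤ A₂ w)
    (hF₂ : ∀ w (p : FreqMomentum L M) (σ : Fin 2) (p' : FreqMomentum L M), ‖F₂ w p σ p'‖ ≤ A₂ w)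
    (hsupp₂ : ∀ w (p : FreqMomentum L M) (σ : Fin 2) (p' : FreqMomentum L M), ρw w < klTorusNorm L (p.2 - cen w) → F₂ w p σ p' = 0)
    (hβL : β ≤ L) {P : SplitConsts} {M4 : ℝ} (hM40 : 0 ≤ M4)
    (hM4 : ∀ X, ‖V j t X‖ ≤ M4) (hM4K : M4 * M4 ≤ 2 ^ 3 * (P.Klam * U) ^ 2)
    (hZS : 64 / Real.pi * 8 * (Real.pi * Real.sqrt 2 / (B.Dtmin - 4 * A) / (B.Dtmin - 4 * A)) * ((∑ c, Lc c * (βc c - αc c)) / (2 * π)) +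
      64 / Real.pi * 8 * (Real.pi * Real.sqrt 2 / (B.Dtmin - 4 * A) * (2 * (2 * ‖c₀‖ + A₁) * (2 / (1 / 10))) / (B.Dtmin - 4 * A) + 2 * (2 * ‖c₀‖ + A₁) * (1 / (B.Dtmin - 4 * A) ^ 2 + Real.pi * Real.sqrt 2 * (2 + 4 * A) / (B.Dtmin - 4 * A) ^ 3)) ≤ 2 ^ 52 * (P.Klam * U) ^ 2)
    (hTH : (393216 / Real.pi * (64 * (klScale klE0 (n + 1) / klScale klE0 j) ^ 2 + (2 * (448 / 3 * Real.exp 2) + 8) + 64) * (2 * (2 * ‖c₀‖ + A₁) * (Real.pi * Real.sqrt 2 / (B.Dtmin - 4 * A)))) ≤ 2 ^ 76 * (P.Klam * U) ^ 2)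
    (hTR : (64 / Real.pi * 8 * (2 * (2 * ‖c₀‖ + A₁) * (Real.pi * Real.sqrt 2 / (B.Dtmin - 4 * A))) * (3 * (8 * (16 : ℝ) ^ (j - (n + 1))) + 512 * 1) +
      4 * (48 / Real.pi * 8 * (2 * (2 * ‖c₀‖ + A₁) * (Real.pi * Real.sqrt 2 / (B.Dtmin - 4 * A))) * (3 * (8 * (16 : ℝ) ^ (j - (n + 1))) + 512 * 1))) * (4 + 8 / 3 * R.Gfr 1 * U ^ 2) ≤ 2 ^ 52 * (P.Klam * U) ^ 2) :
    (klScale klE0 n - klScale klE0 (n + 1)) * ((β * (L : ℝ) ^ 2) ^ 3)⁻¹ *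
      ‖∑ p : FreqMomentum L M, ∑ σ : Fin 2, ∑ p' : FreqMomentum L M,
        if matsubaraInt M p'.1 + matsubaraInt M (omega0 M) = matsubaraInt M p.1 + matsubaraInt M (omega0 M) ∧ p'.2 = p.2 + x - y then
          ((((((Φ j t p) : ℝ) : ℂ) * (((β * (L : ℝ) ^ 2 : ℝ) : ℂ) * propCT L M β μ K p)) * ((((Wd t p') : ℝ) : ℂ) * (((β * (L : ℝ) ^ 2 : ℝ) : ℂ) * propCT L M β μ K p'))) +
              (((((Wd t p) : ℝ) : ℂ) * (((β * (L : ℝ) ^ 2 : ℝ) : ℂ) * propCT L M β μ K p)) * ((((Φ j t p') : ℝ) : ℂ) * (((β * (L : ℝ) ^ 2 : ℝ) : ℂ) * propCT L M β μ K p')))) *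
            (V j t ![((p, σ), 1), ((p', σ), 0), (((omega0 M, y), 0), 0), (((omega0 M, x), 0), 1)] *
              V j t ![((p, σ), 0), ((p', σ), 1), ((((omega0 M).rev, Qm - y), 1), 0), ((((omega0 M).rev, Qm - x), 1), 1)])
        else 0‖ ≤
      (P.Klam * U) ^ 2 * klEngGeo11.phGain (n + 1) (klTorusNorm L (x - y)) + thermalBar klEngGeo11 P U β (n + 1) / 4 +
        2 * ((96 * (512 * Kg / klScale klE0 (n + 1) + 32 * (2 * ‖c₀‖ + A₁) * (4 + 8 / 3 * R.Gfr 1 * U ^ 2) * ((9 * (2 * (448 / 3 * Real.exp 2) + 8) + 4 * 8) + (3 * (8 * (16 : ℝ) ^ (j - (n + 1))) + 512 * 1)) / klScale klE0 (n + 1) ^ 2)) / L) +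
        3 / π * (128 / Real.pi * 8 * (Real.pi * Real.sqrt 2 / (B.Dtmin - 4 * A)) * ((∑ c, (2 * Lc c + 4 * Kg) * (Real.pi / L) * (βc c - αc c)) / (2 * π))) + ε₁ * (2048 * 15367) +
        ∑ w, A₂ w * (4096 * 15381) * (ρw w / π + ((L : ℝ))⁻¹) := by
  have hA0 : 0 ≤ 2 * ‖c₀‖ + A₁ := by positivity
  have hε : 0 ≤ ε₁ := hε1
  have hβ0 : 0 < β := lt_of_lt_of_le (by norm_num [klBetaMin]) hβ
  have hL : (0 : ℝ) < L := by exact_mod_cast Nat.pos_of_ne_zero (NeZero.ne L)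
  have hβL2 : 0 < β * (L : ℝ) ^ 2 := by positivity
  have hΛ1 : 0 < klScale klE0 (n + 1) := klth_klScale_pos (n + 1)
  have hΛj : 0 < klScale klE0 j := klth_klScale_pos j
  have hGfr : 0 ≤ R.Gfr 1 := hR 1
  have h83 : 0 ≤ 8 / 3 * R.Gfr 1 * U ^ 2 := by positivity
  have hG4 : 4 ≤ (4 + 8 / 3 * R.Gfr 1 * U ^ 2) := by linarith only [h83]
  have hG0 : 0 ≤ (4 + 8 / 3 * R.Gfr 1 * U ^ 2) := by linarith only [h83]
  have hA0' : 0 ≤ A := (norm_nonneg _).trans (hAb 0 0 (by norm_num))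
  have hdA : 0 < B.Dtmin - 4 * A := by linarith only [hA]
  set dA : ℝ := B.Dtmin - 4 * A with hdAdef
  have hρ0 : 0 ≤ klTorusNorm L (x - y) := torusSupNorm_nonneg _
  have hρsmall : klTorusNorm L (x - y) ≤ klScale klE0 (n + 1) / 32 := by
    have h4ρ : 4 * klTorusNorm L (x - y) ≤ (4 + 8 / 3 * R.Gfr 1 * U ^ 2) * klTorusNorm L (x - y) := mul_le_mul_of_nonneg_right hG4 hρ0
    linarith only [h4ρ, hq]
  have hKl : 0 ≤ (P.Klam * U) ^ 2 := sq_nonneg _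
  have ha0 : 0 ≤ klScale klE0 n - klScale klE0 (n + 1) := by linarith only [(klmf_klScale_succ_pos_le n).2]
  have hc0 : 0 ≤ ((β * (L : ℝ) ^ 2) ^ 3)⁻¹ := by positivity
  have hMM : 0 ≤ M4 * M4 := mul_nonneg hM40 hM40
  -- (1) the signed row
  have hsig3 := member_direct_signed_le_splitCellsC β μ K B hR hK hAb hA hA20 hμ n ht hβ hβL hn hM Φ hΦ Wd hWd V hj Qm x y hlo hhi hq c₀ F₁ F₂ F₁₀ hsplit
    hA1 hKg hε1 hY0p₁ hY1p₁ hY0m₁ hY1m₁ hαβ hLc hr hserve hcover hcellp hcellm hflat₁ cen hρw hA2 hF₂ hsupp₂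
  have hW : (klScale klE0 n - klScale klE0 (n + 1)) * ((β * (L : ℝ) ^ 2) ^ 3)⁻¹ *
      (∑ w, A₂ w * (512 / 3 * (β * (L : ℝ) ^ 2) ^ 2 / (klScale klE0 n + t * (klScale klE0 (n + 1) - klScale klE0 n)) ^ 2 *
        (2 * (15381 * (ρw w / π + ((L : ℝ))⁻¹) * klScale klE0 n * β * (L : ℝ) ^ 2)))) ≤ ∑ w, A₂ w * (4096 * 15381) * (ρw w / π + ((L : ℝ))⁻¹) := by
    rw [Finset.mul_sum]
    exact Finset.sum_le_sum fun w _ => window_flat_le_base (L := L) β hβ0 n ht (hA2 w) (C := 512 / 3) le_rfl (hρw w)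
  have hI10 : 0 ≤ ∑ c, Lc c * (βc c - αc c) := Finset.sum_nonneg fun c _ => mul_nonneg (hLc c) (sub_nonneg.mpr (hαβ c))
  have hIδ0 : 0 ≤ ∑ c, (2 * Lc c + 4 * Kg) * (Real.pi / L) * (βc c - αc c) :=
    Finset.sum_nonneg fun c _ => mul_nonneg (by have := hLc c; positivity) (sub_nonneg.mpr (hαβ c))
  -- (2) the flat remainder in the door's normalisation and the running member's soft mass
  have hfl := klmsRoom_flat_le (L := L) (M := M) hβ0 μ K n ht (Φ j t) (C := 512 / 3) hε (by norm_num) le_rfl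
  have hsm : klSoftMass L M β μ K n (Φ j t) ≤ 15367 := by
    subst hΦ; exact klSoftMass_runningMember_le β μ K hK hβ hβL n hj ht
  -- (3) the exact reading of the row and the thermal dictionary
  have hread := klmsRowBoundTCC_reading B.Dtmin A (4 + 8 / 3 * R.Gfr 1 * U ^ 2) (2 * ‖c₀‖ + A₁) Kg (∑ c, Lc c * (βc c - αc c))
    (∑ c, (2 * Lc c + 4 * Kg) * (Real.pi / L) * (βc c - αc c)) β n j ((4 + 8 / 3 * R.Gfr 1 * U ^ 2) * klTorusNorm L (x - y)) L
  have hnβ : n ≤ nScales β := by omega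
  have hth := klmsRoom_thermal_le hβ hnβ
  have hq4 : ((4 : ℝ) ^ (nScales β - n))⁻¹ ≤ ((4 : ℝ) ^ (nScales β - (n + 1)))⁻¹ :=
    inv_anti₀ (by positivity) (pow_le_pow_right₀ (by norm_num) (by omega))
  have hth' : Real.pi / β / klScale klE0 (n + 1) ≤ 4 * ((4 : ℝ) ^ (nScales β - (n + 1)))⁻¹ := hth.trans (by linarith only [hq4])
  have hth0 : 0 ≤ Real.pi / β / klScale klE0 (n + 1) := by positivity
  have hq1 : ((4 : ℝ) ^ (nScales β - (n + 1)))⁻¹ ≤ 1 := inv_le_one_of_one_le₀ (one_le_pow₀ (by norm_num))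
  have harith := forward_row_arith_quarterC (LL := (L : ℝ)) (Lt := (96 * (512 * Kg / klScale klE0 (n + 1) + 32 * (2 * ‖c₀‖ + A₁) * (4 + 8 / 3 * R.Gfr 1 * U ^ 2) * ((9 * (2 * (448 / 3 * Real.exp 2) + 8) + 4 * 8) + (3 * (8 * (16 : ℝ) ^ (j - (n + 1))) + 512 * 1)) / klScale klE0 (n + 1) ^ 2)))
    (D := 128 / Real.pi * 8 * (Real.pi * Real.sqrt 2 / (B.Dtmin - 4 * A)) * ((∑ c, (2 * Lc c + 4 * Kg) * (Real.pi / L) * (βc c - αc c)) / (2 * π)))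
    (rfl : klScale klE0 (n + 1) = klE0 * ((4 : ℝ) ^ (n + 1))⁻¹) hρ0 hKl
    (by positivity) (by positivity) hZS (by positivity) hTH (by positivity) (by positivity) hG0 hTR hth0 (by positivity) hth' hq1 two_pow_eighty_le_klEngGeo11_CF
  have hTB : klEngGeo11.CF * (P.Klam * U) ^ 2 * ((4 : ℝ) ^ (nScales β - (n + 1)))⁻¹ = thermalBar klEngGeo11 P U β (n + 1) := rfl
  have hTB0 : 0 ≤ thermalBar klEngGeo11 P U β (n + 1) := by
    rw [← hTB]; exact mul_nonneg (mul_nonneg klEngGeo11_CF_nonneg hKl) (by positivity)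
  -- (4) the sign-blind factorisation for the `min 1` branch
  have hK4 : ∀ X X', ‖V j t X * V j t X'‖ ≤ M4 * M4 := fun X X' => by
    rw [norm_mul]; exact mul_le_mul (hM4 X) (hM4 X') (norm_nonneg _) hM40
  have hfac := klmd_sum3_ite_mul_le
    (fun (p : FreqMomentum L M) (σ : Fin 2) (p' : FreqMomentum L M) =>
      matsubaraInt M p'.1 + matsubaraInt M (omega0 M) = matsubaraInt M p.1 + matsubaraInt M (omega0 M) ∧ p'.2 = p.2 + x - y)
    (fun (p : FreqMomentum L M) (σ : Fin 2) (p' : FreqMomentum L M) =>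
      ((((((Φ j t p) : ℝ) : ℂ) * (((β * (L : ℝ) ^ 2 : ℝ) : ℂ) * propCT L M β μ K p)) * ((((Wd t p') : ℝ) : ℂ) * (((β * (L : ℝ) ^ 2 : ℝ) : ℂ) * propCT L M β μ K p'))) +
        (((((Wd t p) : ℝ) : ℂ) * (((β * (L : ℝ) ^ 2 : ℝ) : ℂ) * propCT L M β μ K p)) * ((((Φ j t p') : ℝ) : ℂ) * (((β * (L : ℝ) ^ 2 : ℝ) : ℂ) * propCT L M β μ K p')))))
    (fun (p : FreqMomentum L M) (σ : Fin 2) (p' : FreqMomentum L M) =>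
      V j t ![((p, σ), 1), ((p', σ), 0), (((omega0 M, y), 0), 0), (((omega0 M, x), 0), 1)] *
        V j t ![((p, σ), 0), ((p', σ), 1), ((((omega0 M).rev, Qm - y), 1), 0), ((((omega0 M).rev, Qm - x), 1), 1)])
    (fun _ _ _ _ => hK4 _ _)
  beta_reduce at hfac
  have hmass : (klScale klE0 n - klScale klE0 (n + 1)) * ((β * (L : ℝ) ^ 2) ^ 3)⁻¹ *
      (∑ p : FreqMomentum L M, ∑ σ : Fin 2, ∑ p' : FreqMomentum L M,
          (if matsubaraInt M p'.1 + matsubaraInt M (omega0 M) = matsubaraInt M p.1 + matsubaraInt M (omega0 M) ∧ p'.2 = p.2 + x - y then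
            ‖(((((Φ j t p) : ℝ) : ℂ) * (((β * (L : ℝ) ^ 2 : ℝ) : ℂ) * propCT L M β μ K p)) * ((((Wd t p') : ℝ) : ℂ) * (((β * (L : ℝ) ^ 2 : ℝ) : ℂ) * propCT L M β μ K p'))) +
              (((((Wd t p) : ℝ) : ℂ) * (((β * (L : ℝ) ^ 2 : ℝ) : ℂ) * propCT L M β μ K p)) * ((((Φ j t p') : ℝ) : ℂ) * (((β * (L : ℝ) ^ 2 : ℝ) : ℂ) * propCT L M β μ K p')))‖
          else 0)) ≤ 2048 * 15367 := by
    have h := Wd_member_row_flat_le (M := M) β μ K hK hβ hβL n hj ht x y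
    simp only [hΦ, hWd]
    exact h
  -- (5) abbreviate and assemble
  set a : ℝ := klScale klE0 n - klScale klE0 (n + 1) with ha
  set c : ℝ := ((β * (L : ℝ) ^ 2) ^ 3)⁻¹ with hc
  set nS : ℝ := ‖∑ p : FreqMomentum L M, ∑ σ : Fin 2, ∑ p' : FreqMomentum L M,
        if matsubaraInt M p'.1 + matsubaraInt M (omega0 M) = matsubaraInt M p.1 + matsubaraInt M (omega0 M) ∧ p'.2 = p.2 + x - y then
          ((((((Φ j t p) : ℝ) : ℂ) * (((β * (L : ℝ) ^ 2 : ℝ) : ℂ) * propCT L M β μ K p)) * ((((Wd t p') : ℝ) : ℂ) * (((β * (L : ℝ) ^ 2 : ℝ) : ℂ) * propCT L M β μ K p'))) +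
              (((((Wd t p) : ℝ) : ℂ) * (((β * (L : ℝ) ^ 2 : ℝ) : ℂ) * propCT L M β μ K p)) * ((((Φ j t p') : ℝ) : ℂ) * (((β * (L : ℝ) ^ 2 : ℝ) : ℂ) * propCT L M β μ K p')))) *
            (V j t ![((p, σ), 1), ((p', σ), 0), (((omega0 M, y), 0), 0), (((omega0 M, x), 0), 1)] *
              V j t ![((p, σ), 0), ((p', σ), 1), ((((omega0 M).rev, Qm - y), 1), 0), ((((omega0 M).rev, Qm - x), 1), 1)])
        else 0‖ with hnS
  set Sd : ℝ := ∑ p : FreqMomentum L M, ∑ σ : Fin 2, ∑ p' : FreqMomentum L M,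
          (if matsubaraInt M p'.1 + matsubaraInt M (omega0 M) = matsubaraInt M p.1 + matsubaraInt M (omega0 M) ∧ p'.2 = p.2 + x - y then
            ‖(((((Φ j t p) : ℝ) : ℂ) * (((β * (L : ℝ) ^ 2 : ℝ) : ℂ) * propCT L M β μ K p)) * ((((Wd t p') : ℝ) : ℂ) * (((β * (L : ℝ) ^ 2 : ℝ) : ℂ) * propCT L M β μ K p'))) +
              (((((Wd t p) : ℝ) : ℂ) * (((β * (L : ℝ) ^ 2 : ℝ) : ℂ) * propCT L M β μ K p)) * ((((Φ j t p') : ℝ) : ℂ) * (((β * (L : ℝ) ^ 2 : ℝ) : ℂ) * propCT L M β μ K p')))‖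
          else 0) with hSd
  set T' : ℝ := thermalBar klEngGeo11 P U β (n + 1) / 4 + 2 * ((96 * (512 * Kg / klScale klE0 (n + 1) + 32 * (2 * ‖c₀‖ + A₁) * (4 + 8 / 3 * R.Gfr 1 * U ^ 2) * ((9 * (2 * (448 / 3 * Real.exp 2) + 8) + 4 * 8) + (3 * (8 * (16 : ℝ) ^ (j - (n + 1))) + 512 * 1)) / klScale klE0 (n + 1) ^ 2)) / L) +
    3 / π * (128 / Real.pi * 8 * (Real.pi * Real.sqrt 2 / (B.Dtmin - 4 * A)) * ((∑ c, (2 * Lc c + 4 * Kg) * (Real.pi / L) * (βc c - αc c)) / (2 * π))) + ε₁ * (2048 * 15367) +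
    ∑ w, A₂ w * (4096 * 15381) * (ρw w / π + ((L : ℝ))⁻¹) with hT'
  have hWs0 : 0 ≤ ∑ w, A₂ w * (4096 * 15381) * (ρw w / π + ((L : ℝ))⁻¹) := Finset.sum_nonneg fun w _ => by have := hA2 w; have := hρw w; positivity
  have hT'0 : 0 ≤ T' := by
    rw [hT']; exact add_nonneg (add_nonneg (add_nonneg (add_nonneg (by linarith only [hTB0]) (by positivity)) (by positivity)) (by positivity)) hWs0
  have hac : 0 ≤ a * c := mul_nonneg ha0 hc0
  -- b ≤ 2·(a·RowC(2‖c₀‖+A₁, K_g, I₁, I_δ)) + ε₁·2048·15367 + the window family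
  have hb_le : a * c * nS ≤ 2 * (a * klmsRowBoundTCC B.Dtmin A (4 + 8 / 3 * R.Gfr 1 * U ^ 2) (2 * ‖c₀‖ + A₁) Kg (∑ c, Lc c * (βc c - αc c)) (∑ c, (2 * Lc c + 4 * Kg) * (Real.pi / L) * (βc c - αc c)) β n j ((4 + 8 / 3 * R.Gfr 1 * U ^ 2) * klTorusNorm L (x - y)) L) + ε₁ * (2048 * 15367) +
      ∑ w, A₂ w * (4096 * 15381) * (ρw w / π + ((L : ℝ))⁻¹) := by
    have e1 : a * c * ((β * (L : ℝ) ^ 2) ^ 2 *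
          (β * (L : ℝ) ^ 2 * klmsRowBoundTCC B.Dtmin A (4 + 8 / 3 * R.Gfr 1 * U ^ 2) (2 * ‖c₀‖ + A₁) Kg (∑ c, Lc c * (βc c - αc c)) (∑ c, (2 * Lc c + 4 * Kg) * (Real.pi / L) * (βc c - αc c)) β n j ((4 + 8 / 3 * R.Gfr 1 * U ^ 2) * klTorusNorm L (x - y)) L +
            β * (L : ℝ) ^ 2 * klmsRowBoundTCC B.Dtmin A (4 + 8 / 3 * R.Gfr 1 * U ^ 2) (2 * ‖c₀‖ + A₁) Kg (∑ c, Lc c * (βc c - αc c)) (∑ c, (2 * Lc c + 4 * Kg) * (Real.pi / L) * (βc c - αc c)) β n j ((4 + 8 / 3 * R.Gfr 1 * U ^ 2) * klTorusNorm L (x - y)) L)) =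
        2 * (a * klmsRowBoundTCC B.Dtmin A (4 + 8 / 3 * R.Gfr 1 * U ^ 2) (2 * ‖c₀‖ + A₁) Kg (∑ c, Lc c * (βc c - αc c)) (∑ c, (2 * Lc c + 4 * Kg) * (Real.pi / L) * (βc c - αc c)) β n j ((4 + 8 / 3 * R.Gfr 1 * U ^ 2) * klTorusNorm L (x - y)) L) := by
      generalize klmsRowBoundTCC B.Dtmin A (4 + 8 / 3 * R.Gfr 1 * U ^ 2) (2 * ‖c₀‖ + A₁) Kg (∑ c, Lc c * (βc c - αc c)) (∑ c, (2 * Lc c + 4 * Kg) * (Real.pi / L) * (βc c - αc c)) β n j ((4 + 8 / 3 * R.Gfr 1 * U ^ 2) * klTorusNorm L (x - y)) L = Rw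
      rw [hc]; field_simp; ring
    have h1 := mul_le_mul_of_nonneg_left hsig3 hac
    have h2 : ε₁ * (2048 * klSoftMass L M β μ K n (Φ j t)) ≤ ε₁ * (2048 * 15367) := mul_le_mul_of_nonneg_left (by linarith only [hsm]) hε
    linarith only [h1, e1, hfl, h2, hW]
  -- h2: below resolution
  have h2 : a * c * nS ≤ (P.Klam * U) ^ 2 * 2 ^ 28 * (2 ^ 24 * ((4 : ℝ) ^ (n + 1))⁻¹ + 2 ^ 24 * klTorusNorm L (x - y) / klE0 * (4 : ℝ) ^ (n + 1)) + T' := by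
    rw [hread] at hb_le
    rw [hT', ← hTB]
    linarith only [hb_le, harith]
  -- h1: sign blind
  have h1 : a * c * nS ≤ (P.Klam * U) ^ 2 * 2 ^ 28 + T' := by
    have hmS : a * c * nS ≤ M4 * M4 * (a * c * Sd) := by
      calc a * c * nS ≤ a * c * (M4 * M4 * Sd) := mul_le_mul_of_nonneg_left hfac hac
        _ = M4 * M4 * (a * c * Sd) := by ring
    have h3 : M4 * M4 * (a * c * Sd) ≤ M4 * M4 * (2048 * 15367) := mul_le_mul_of_nonneg_left hmass hMM
    have h4 : M4 * M4 * (2048 * 15367) ≤ 2 ^ 3 * (P.Klam * U) ^ 2 * (2048 * 15367) := mul_le_mul_of_nonneg_right hM4K (by norm_num)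
    have h5 : 2 ^ 3 * (P.Klam * U) ^ 2 * (2048 * 15367) ≤ (P.Klam * U) ^ 2 * 2 ^ 28 := by
      have : (2 : ℝ) ^ 3 * (2048 * 15367) ≤ 2 ^ 28 := by norm_num
      nlinarith only [this, hKl]
    linarith only [hmS, h3, h4, h5, hT'0]
  -- h3: above resolution, from h1 (inside the window `ABOVE ≥ 1`)
  have h3 : 0 < klTorusNorm L (x - y) →
      a * c * nS ≤ (P.Klam * U) ^ 2 * 2 ^ 28 * (2 ^ 24 * (klE0 * ((4 : ℝ) ^ (n + 1))⁻¹) / klTorusNorm L (x - y) +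
        2 ^ 24 * Real.sqrt klE0 * ((2 : ℝ) ^ (n + 1))⁻¹) + T' := fun hρ => by
    have hsc : klE0 * ((4 : ℝ) ^ (n + 1))⁻¹ = klScale klE0 (n + 1) := rfl
    have hA1 : 1 ≤ 2 ^ 24 * (klE0 * ((4 : ℝ) ^ (n + 1))⁻¹) / klTorusNorm L (x - y) := by
      rw [hsc, one_le_div hρ]; linarith only [hρsmall, hΛ1]
    have hA2 : 0 ≤ 2 ^ 24 * Real.sqrt klE0 * ((2 : ℝ) ^ (n + 1))⁻¹ := by positivity
    have hX : (P.Klam * U) ^ 2 * 2 ^ 28 ≤ (P.Klam * U) ^ 2 * 2 ^ 28 *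
        (2 ^ 24 * (klE0 * ((4 : ℝ) ^ (n + 1))⁻¹) / klTorusNorm L (x - y) + 2 ^ 24 * Real.sqrt klE0 * ((2 : ℝ) ^ (n + 1))⁻¹) := by
      have h := mul_le_mul_of_nonneg_left (show (1 : ℝ) ≤ 2 ^ 24 * (klE0 * ((4 : ℝ) ^ (n + 1))⁻¹) / klTorusNorm L (x - y) +
        2 ^ 24 * Real.sqrt klE0 * ((2 : ℝ) ^ (n + 1))⁻¹ by linarith) (by positivity : (0 : ℝ) ≤ (P.Klam * U) ^ 2 * 2 ^ 28)
      rwa [mul_one] at h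
    linarith only [h1, hX]
  have hG5 := klg5_phGain_reading (n := n + 1) hρ0 h1 h2 h3
  have hlift := mul_le_mul_of_nonneg_left (klEngGeo5_phGain_le_klEngGeo11 (n + 1) (klTorusNorm L (x - y))) hKl
  rw [hT'] at hG5
  linarith only [hG5, hlift]



end Model

end Summit.HubbardSuperconductivity.HubbardSuperconductivity.Theorems.KLRegimeSplit

end
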